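import Summits.AnomalousDissipation.AnomalousDissipation.Theorems.BaireTransferDenseLoudDesignerForcesErgodicConjugatedMildIdentity

/-!
# Every smooth honest state is in the range of the frame `S` (registered tools stub S6₁ of the crux
# `DenseLoudDesignerForces`, line ergodic-budget-selection-closing, block N)

Summit-side glue: for the frame operator `S = (1+A)^{-1/2}` pinned on the Stokes mode basis by
`S (b i) = (1 + m i)^{-1/2} b i`, and a smooth divergence-free mean-zero field `v`, the explicit preimage
`S([v] − [Δv])` satisfies `S (S([v] − [Δv])) = [v]` (`[·] = stateOf`).  Modewise: `⟪b i, S S w⟫ = (1+m_i)⁻¹⟪b i, w⟫`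
(`inner_basis_apply_of_apply_basis`, landed with S5b) and `⟪b i, [v] − [Δv]⟫ = (1 + m_i) ∫⟪v, φ_i⟫ = (1+m_i)⟪b i, [v]⟫`
(`inner_stateOf_right_of_coe_eq`, `inner_stateOf_laplacian_right_of_coe_eq`); vectors with the same coordinates in a
Hilbert basis are equal.  This is the existence twin of `eq_frame_apply_of_frame_apply_eq_stateOf` (S5b, p162203): frame
curves and the frame forcing of the smooth-model assembly EXIST.
-/

set_option linter.dupNamespace false

noncomputable section

open Filter Set Function MeasureTheory
open scoped InnerProductSpace RealInnerProductSpace Topology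

namespace Summit.AnomalousDissipation.AnomalousDissipation.Theorems.DenseLoudDesignerForces.Ergodic

open Literature.Analysis.FunctionSpaces Literature.Analysis.FunctionSpaces.Torus
open Literature.Analysis.FluidPDE Literature.Analysis.FluidPDE.Torus

/-- Two vectors of a Hilbert space with the same coordinates in a Hilbert basis are equal. [folklore] -/
theorem eq_of_forall_inner_basis_eq {ι E : Type*} [NormedAddCommGroup E] [InnerProductSpace ℝ E] [CompleteSpace E]
    (b : HilbertBasis ι ℝ E) {x y : E} (h : ∀ i, ⟪b i, x⟫_ℝ = ⟪b i, y⟫_ℝ) : x = y := by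
  apply b.repr.injective
  ext i
  rw [b.repr_apply_apply, b.repr_apply_apply, h i]

/-- **Every smooth honest state is in the range of the frame**: `S (S([v] − [Δv])) = [v]` for the frame operator `S = (1+A)^{-1/2}` pinned on the
Stokes mode basis and every smooth divergence-free mean-zero `v` (registered tools stub S6₁).  Modewise verification:
`⟪b i, S S([v] − [Δv])⟫ = (1+m_i)⁻¹ (⟪b i, [v]⟫ − ⟪b i, [Δv]⟫) = (1+m_i)⁻¹ (1 + m_i) ∫⟪v, φ_i⟫ = ⟪b i, [v]⟫`. [folklore] -/
theorem stub_framePreimageTools (ι : Type) (b : HilbertBasis ι ℝ Hsp) (m : ι → ℝ)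
    (hb : ∀ i, ∃ (k : Fin 3 → ℤ) (a : EuclideanSpace ℝ (Fin 3)) (c : Bool), k ≠ 0 ∧ a ≠ 0 ∧ ⟪latticeVec k, a⟫_ℝ = 0 ∧
      ((b i : Hsp) : Lp (EuclideanSpace ℝ (Fin 3)) 2 (volume : Measure (UnitAddTorus (Fin 3)))) = stokesModeL2 k a c ∧
      m i = stokesEigenvalue k)
    (S : Hsp →L[ℝ] Hsp) (hS : ∀ i, S (b i) = ((1 + m i) ^ (-(1 / 2 : ℝ))) • b i)
    {v : (UnitAddTorus (Fin 3)) → (EuclideanSpace ℝ (Fin 3))} (hv : IsSmooth v) (hd : IsDivFree v) (hm : HasZeroMean v) :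
    S (S (stateOf v - stateOf (laplacian v))) = stateOf v := by
  refine eq_of_forall_inner_basis_eq b fun i => ?_
  obtain ⟨k, a, c, -, -, -, hcoe, hmi⟩ := hb i
  -- positivity of `1 + m i`
  have hm0 : 0 ≤ m i := hmi ▸ stokesEigenvalue_nonneg k
  have h1 : 0 < 1 + m i := by linarith
  -- the two applications of `S`
  have hSS : ⟪b i, S (S (stateOf v - stateOf (laplacian v)))⟫_ℝ =
      (1 + m i)⁻¹ * ⟪b i, stateOf v - stateOf (laplacian v)⟫_ℝ := by
    rw [inner_basis_apply_of_apply_basis b hS, inner_basis_apply_of_apply_basis b hS, ← mul_assoc]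
    congr 1
    rw [← Real.rpow_add h1, show (-(1 / 2 : ℝ)) + -(1 / 2 : ℝ) = -1 by norm_num, Real.rpow_neg_one]
  -- the coordinates of `[v]` and `[Δv]`
  have hv' : ⟪b i, stateOf v⟫_ℝ = ∫ x, ⟪v x, stokesMode k a c x⟫_ℝ := inner_stateOf_right_of_coe_eq hv hd hm hcoe
  have hΔ : ⟪b i, stateOf (laplacian v)⟫_ℝ = -(stokesEigenvalue k * ∫ x, ⟪v x, stokesMode k a c x⟫_ℝ) :=
    inner_stateOf_laplacian_right_of_coe_eq hv hd hcoe
  rw [hSS, inner_sub_right, hv', hΔ, ← hmi]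
  field_simp
  ring

end Summit.AnomalousDissipation.AnomalousDissipation.Theorems.DenseLoudDesignerForces.Ergodic

end
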